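import Mathlib
import Literature.NumberTheory.Transcendental.RoyCriterion
import Literature.NumberTheory.Transcendental.RoyCriterionProofs
import Summits.Schanuel.Schanuel.Theorems.SoloBlindPadeContent
import Summits.Schanuel.Schanuel.Theorems.SoloBlindLogTrunc
import HarnessLib

/-!
# Twisted-order forcing at the torsion point `u = −1` of `G_m` (Lemma F′ at `p = 2`)

**Theorem** (`two_pow_dvd_eval_of_taylorInt_eq_zero`). For every `P ∈ ℤ[X₀,X₁]` and `m : ℕ`: if
`ord₀ P(w, e^w) ≥ m` — i.e. the integer Taylor coefficients `taylorInt n P = (DⁿP)(0,1)` vanish for `n < m`,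
`D = ∂₀ + X₁∂₁` (`Literature…RoyCriterion.royD`) — then `2^{⌈m/2⌉} ∣ P(0, −1)`.

So a high order of vanishing at the point `(0, 1) = (0, e⁰)` FORCES vanishing of `P(0,·)` at the `2`-torsion
point `−1` once `|P(0,−1)| < 2^{⌈m/2⌉}`; applied to `DʲP` it forces a TWISTED order `ord₀ P(w, −e^w)`.  The
bound is sharp: the diagonal Padé approximants `P_n = D_n(X₀)X₁ − N_n(X₀)` of `e^w` (`m = 2n+1`) have
`P_n(0,−1) = −2·(2n)!/n!`, of `2`-adic valuation exactly `n+1 = ⌈m/2⌉` (checked `n ≤ 15`, work/twist_zero).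
There is NO dependence on the bidegree of `P` (contrast: archimedean Schwarz-lemma forcing needs the degree).

**Mechanism** (prose: run/shared/lean/ideation/Schanuel/solo-blind/paper/twist.md §1, Lemma F / F′).
`Φ(P) := P(log(1+z), 1+z) = Σ_{n ≥ m} c_n zⁿ` (ORDER TRANSFER, `coeff_aeval_logPair_eq_zero`) with
`|c_n|₂ ≤ 2^{⌊n/2⌋}` (the `2`-integrality profile `S₂` of `ℤ[log(1+z), 1+z]`, `aeval_logPair_mem_jetSp`) — both
from `SoloBlindPadeContent`.  One wants to substitute `z = −2` (`1+z = −1`, "`log(−1) = 0`"); the series does not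
converge, so we pass through the TRUNCATION `LOG_M(z) = Σ_{j ≤ M} (−1)^{j+1}zʲ/j`:
* STEP (e) — the finite form of `log₂(−1) = 0`: `|LOG_M(−2)|₂ ≤ 2^{log₂M − M}` (`padicNorm_logTrunc_neg_two_le`).
  Proof: with `Y = 2X + X²` (`1+Y = (1+X)²`, `Y(−2) = 0`) the polynomial `H_M = LOG_M∘Y − 2·LOG_M` satisfies
  `(1+X)·H_M′ = 2((−X)^M − (−Y)^M)`, hence has no terms in degrees `≤ M`; evaluating at `−2`,
  `−2·LOG_M(−2) = H_M(−2) = Σ_{k>M} h_k(−2)^k` with `|h_k|₂ ≤ 2^{log₂ M}`.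
* AGREEMENT (`coeff_aeval_pair_congr`): `P(LOG_M,1+z) ≡ Φ(P) (mod z^{M+1})`, so `Q := P(LOG_M, 1+X) ∈ ℚ[X]` has no
  terms below degree `m` (for `m ≤ M+1`) and lies in `S₂`; therefore `|Q(−2)|₂ ≤ max_{k ≥ m} 2^{⌊k/2⌋−k} = 2^{−⌈m/2⌉}`.
* NATURALITY: `Q(−2) = P(ℓ_M, −1)`, `ℓ_M = LOG_M(−2)`; STEP (d) (`padicNorm_aeval_sub_eval_le`):
  `|P(ℓ_M,−1) − P(0,−1)|₂ ≤ |ℓ_M|₂`.  With `M = 2^{m+4}`: `|P(0,−1)|₂ ≤ 2^{−⌈m/2⌉}`, i.e. `2^{⌈m/2⌉} ∣ P(0,−1)`.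

Role in the programme of this seat (solo-blind, s21): Lemma F′ is the uniform (`T₀`-free) case of the `p`-adic
torsion forcing (Lemma F) behind THEOREM S (`v*(t₀,t₁) = (1+t₀+t₁)/2` on `t₀ < 1`: no widening of Roy's window from
the supply side); see paper/twist.md.  [this work]
-/

noncomputable section

open Finset PowerSeries

namespace Summit.Schanuel.Schanuel.Theorems

open Literature.NumberTheory.Transcendental

/-! ### STEP (d): moving the first argument `2`-adically -/

/-- STEP (d): rows `a ≥ 1` die modulo `LOG_M(−2)`: `|P(ℓ, −1) − P(0, −1)|₂ ≤ |ℓ|₂` for `|ℓ|₂ ≤ 1`. [this work] -/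
theorem padicNorm_aeval_sub_eval_le (P : MvPolynomial (Fin 2) ℤ) (ℓ : ℚ) (hℓ : padicNorm 2 ℓ ≤ 1) :
    padicNorm 2 (MvPolynomial.aeval ![ℓ, -1] P - ((MvPolynomial.eval ![0, -1] P : ℤ) : ℚ))
      ≤ padicNorm 2 ℓ := by
  induction P using MvPolynomial.induction_on with
  | C a =>
    rw [MvPolynomial.aeval_C, MvPolynomial.eval_C, algebraMap_int_eq, eq_intCast, sub_self,
      padicNorm.zero]
    exact padicNorm.nonneg _
  | add p q hp hq =>
    rw [map_add, map_add, Int.cast_add, add_sub_add_comm]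
    exact padicNorm.nonarchimedean.trans (max_le hp hq)
  | mul_X p i hp =>
    have hB : padicNorm 2 ((MvPolynomial.eval ![0, -1] p : ℤ) : ℚ) ≤ 1 := padicNorm.of_int _
    have hA : padicNorm 2 (MvPolynomial.aeval ![ℓ, -1] p) ≤ 1 := by
      have h3 := padicNorm.nonarchimedean (p := 2)
        (q := MvPolynomial.aeval ![ℓ, -1] p - ((MvPolynomial.eval ![0, -1] p : ℤ) : ℚ))
        (r := ((MvPolynomial.eval ![0, -1] p : ℤ) : ℚ))
      rw [sub_add_cancel] at h3
      exact h3.trans (max_le (hp.trans hℓ) hB)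
    rw [map_mul, map_mul, MvPolynomial.aeval_X, MvPolynomial.eval_X, Int.cast_mul]
    have hi : i = 0 ∨ i = 1 := by fin_cases i <;> simp
    rcases hi with rfl | rfl
    · have e1 : (![ℓ, -1] : Fin 2 → ℚ) 0 = ℓ := rfl
      have e2 : (![(0 : ℤ), -1] : Fin 2 → ℤ) 0 = 0 := rfl
      rw [e1, e2, Int.cast_zero, mul_zero, sub_zero, padicNorm.mul]
      calc padicNorm 2 (MvPolynomial.aeval ![ℓ, -1] p) * padicNorm 2 ℓ
          ≤ 1 * padicNorm 2 ℓ := mul_le_mul_of_nonneg_right hA (padicNorm.nonneg _)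
        _ = padicNorm 2 ℓ := one_mul _
    · have e1 : (![ℓ, -1] : Fin 2 → ℚ) 1 = -1 := rfl
      have e2 : (![(0 : ℤ), -1] : Fin 2 → ℤ) 1 = -1 := rfl
      rw [e1, e2, Int.cast_neg, Int.cast_one, mul_neg_one, mul_neg_one, neg_sub_neg,
        ← padicNorm.neg (p := 2), neg_sub]
      exact hp

/-! ### Assembly: truncated logarithm as a power series, agreement, naturality -/

/-- The coefficient function of `log(1+z)`. -/
def logCoeff (j : ℕ) : ℚ := ite (j = 0) (0 : ℚ) ((-1) ^ (j + 1) / (j : ℚ))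

/-- `LOG_M = Σ_{j ≤ M} c_j Xʲ` with `c_j = logCoeff j`. [this work] -/
theorem logTrunc_eq (M : ℕ) :
    logTrunc M = ∑ j ∈ Finset.range (M + 1), Polynomial.C (logCoeff j) * Polynomial.X ^ j := rfl

/-- The coefficients of `LOG_M`. [this work] -/
theorem coeff_logTrunc (M k : ℕ) :
    (logTrunc M).coeff k = if k ≤ M then logCoeff k else 0 := by
  rw [logTrunc_eq, Polynomial.finsetSum_coeff]
  simp only [Polynomial.coeff_C_mul_X_pow]
  rw [Finset.sum_ite_eq (Finset.range (M + 1)) k logCoeff]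
  simp only [Finset.mem_range, Nat.lt_succ_iff]

/-- AGREEMENT: if `A ≡ B (mod z^{M+1})` then `P(A,1+z) ≡ P(B,1+z) (mod z^{M+1})`. [this work] -/
theorem coeff_aeval_pair_congr (A B : ℚ⟦X⟧) (M : ℕ) (hAB : ∀ k ≤ M, coeff k A = coeff k B)
    (P : MvPolynomial (Fin 2) ℤ) :
    ∀ k ≤ M, coeff k (MvPolynomial.aeval ![A, 1 + X] P)
      = coeff k (MvPolynomial.aeval ![B, 1 + X] P) := by
  induction P using MvPolynomial.induction_on with
  | C a => intro k _; rw [aeval_logPair_C, aeval_logPair_C]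
  | add p q hp hq => intro k hk; rw [map_add, map_add, map_add, map_add, hp k hk, hq k hk]
  | mul_X q i hq =>
    intro k hk
    rw [map_mul (MvPolynomial.aeval ![A, 1 + X]), map_mul (MvPolynomial.aeval ![B, 1 + X]),
      PowerSeries.coeff_mul, PowerSeries.coeff_mul]
    refine Finset.sum_congr rfl fun ab hab => ?_
    have hab' : ab.1 + ab.2 = k := Finset.HasAntidiagonal.mem_antidiagonal.mp hab
    have ha : ab.1 ≤ k := by omega
    have hb : ab.2 ≤ k := by omega
    rw [hq ab.1 (ha.trans hk)]
    congr 1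
    have hi : i = 0 ∨ i = 1 := by fin_cases i <;> simp
    rcases hi with rfl | rfl
    · rw [aeval_logPair_X_zero, aeval_logPair_X_zero]; exact hAB ab.2 (hb.trans hk)
    · rw [aeval_logPair_X_one, aeval_logPair_X_one]

/-- The truncation agrees with `log(1+z)` up to degree `M`. -/
theorem coeff_coe_logTrunc_eq (M k : ℕ) (hk : k ≤ M) :
    coeff k ((logTrunc M : Polynomial ℚ) : ℚ⟦X⟧)
      = coeff k (PowerSeries.mk fun j : ℕ => ite (j = 0) (0 : ℚ) ((-1) ^ (j + 1) / (j : ℚ))) := by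
  rw [Polynomial.coeff_coe, coeff_logTrunc, if_pos hk, coeff_mk, logCoeff]

/-- The truncation lies in `S₂`. -/
theorem coe_logTrunc_mem_jetSp (M : ℕ) :
    ∀ j, padicNorm 2 (coeff j ((logTrunc M : Polynomial ℚ) : ℚ⟦X⟧)) ≤ (2 : ℚ) ^ (j / 2) := by
  intro j
  by_cases hj : j ≤ M
  · rw [coeff_coe_logTrunc_eq M j hj]
    have := logSeries_mem_jetSp (p := 2) j
    exact_mod_cast this
  · rw [Polynomial.coeff_coe, coeff_logTrunc, if_neg hj, padicNorm.zero]; positivity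

/-- NATURALITY (coefficients): the polynomial `P(LOG_M, 1+X)` coerced to `ℚ⟦X⟧` is `Φ_M(P)`. [this work] -/
theorem coe_aeval_logTrunc (M : ℕ) (P : MvPolynomial (Fin 2) ℤ) :
    ((MvPolynomial.aeval ![logTrunc M, 1 + Polynomial.X] P : Polynomial ℚ) : ℚ⟦X⟧)
      = MvPolynomial.aeval ![((logTrunc M : Polynomial ℚ) : ℚ⟦X⟧), 1 + X] P := by
  rw [MvPolynomial.aeval_def, MvPolynomial.aeval_def, ← Polynomial.coeToPowerSeries.ringHom_apply,
    MvPolynomial.eval₂_comp_left]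
  congr 1
  · exact Subsingleton.elim _ _
  · funext i
    have hi : i = 0 ∨ i = 1 := by fin_cases i <;> simp
    rcases hi with rfl | rfl
    · rfl
    · simp [Polynomial.coeToPowerSeries.ringHom_apply, Polynomial.coe_add, Polynomial.coe_one,
        Polynomial.coe_X]

/-- NATURALITY (evaluation): `P(LOG_M, 1+X)(−2) = P(ℓ_M, −1)`, `ℓ_M := LOG_M(−2)`. [this work] -/
theorem eval_neg_two_aeval_logTrunc (M : ℕ) (P : MvPolynomial (Fin 2) ℤ) :
    (MvPolynomial.aeval ![logTrunc M, 1 + Polynomial.X] P).eval (-2)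
      = MvPolynomial.aeval ![(logTrunc M).eval (-2), (-1 : ℚ)] P := by
  rw [MvPolynomial.aeval_def, MvPolynomial.aeval_def, ← Polynomial.coe_evalRingHom,
    MvPolynomial.eval₂_comp_left]
  congr 1
  · exact Subsingleton.elim _ _
  · funext i
    have hi : i = 0 ∨ i = 1 := by fin_cases i <;> simp
    rcases hi with rfl | rfl
    · rfl
    · simp [Polynomial.coe_evalRingHom]; norm_num

/-- MAIN (Lemma F′ at `p = 2`): `ord₀ P(w,e^w) ≥ m ⟹ 2^{⌈m/2⌉} ∣ P(0,−1)`. [this work] -/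
theorem two_pow_dvd_eval_of_taylorInt_eq_zero (P : MvPolynomial (Fin 2) ℤ) {m : ℕ}
    (h : ∀ n < m, taylorInt n P = 0) :
    (2 : ℤ) ^ ((m + 1) / 2) ∣ MvPolynomial.eval ![0, -1] P := by
  -- the truncation order `M = 2^{m+4}` (a power of two, so that `Nat.log 2 M` is exact)
  set M : ℕ := 2 ^ (m + 4) with hMdef
  have hm2 : m < 2 ^ m := Nat.lt_two_pow_self
  have hM16 : M = 2 ^ m * 2 ^ 4 := by rw [hMdef, pow_add]
  have hbig : m + 4 + (m + 1) / 2 ≤ M := by rw [hM16]; norm_num; omega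
  have hlogM : Nat.log 2 M = m + 4 := by rw [hMdef, Nat.log_pow (by norm_num)]
  set Lfull : ℚ⟦X⟧ := PowerSeries.mk fun j : ℕ => ite (j = 0) (0 : ℚ) ((-1) ^ (j + 1) / (j : ℚ))
    with hLfull
  set LM : ℚ⟦X⟧ := ((logTrunc M : Polynomial ℚ) : ℚ⟦X⟧) with hLM
  set Q : Polynomial ℚ := MvPolynomial.aeval ![logTrunc M, 1 + Polynomial.X] P with hQ
  set ℓ : ℚ := (logTrunc M).eval (-2) with hℓdef
  set c : ℕ := (m + 1) / 2 with hc
  -- (1) order transfer for the full logarithm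
  have hL : (1 + X : ℚ⟦X⟧) * d⁄dX ℚ Lfull = 1 := one_add_X_mul_derivative_logSeries
  have hL0 : constantCoeff Lfull = 0 := by
    rw [← coeff_zero_eq_constantCoeff_apply, coeff_mk, if_pos rfl]
  have hvan : ∀ k < m, coeff k (MvPolynomial.aeval ![Lfull, 1 + X] P) = 0 :=
    coeff_aeval_logPair_eq_zero (θ := fun f => (1 + X : ℚ⟦X⟧) * d⁄dX ℚ f) (fun f => rfl) hL hL0 P h
  -- (2) agreement up to degree `M` ⇒ the polynomial `Q = P(LOG_M, 1+X)` has no terms below degree `m`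
  have hQcoe : (Q : ℚ⟦X⟧) = MvPolynomial.aeval ![LM, 1 + X] P := coe_aeval_logTrunc M P
  have hQvan : ∀ k < m, Q.coeff k = 0 := by
    intro k hk
    have hkM : k ≤ M := by omega
    rw [← Polynomial.coeff_coe, hQcoe,
      coeff_aeval_pair_congr LM Lfull M (fun j hj => coeff_coe_logTrunc_eq M j hj) P k hkM]
    exact hvan k hk
  -- (3) `Q ∈ S₂`
  have hQS : ∀ k, padicNorm 2 (Q.coeff k) ≤ (2 : ℚ) ^ (k / 2) := by
    intro k
    rw [← Polynomial.coeff_coe, hQcoe]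
    have := aeval_logPair_mem_jetSp (p := 2) (coe_logTrunc_mem_jetSp M) P k
    exact_mod_cast this
  -- (5) `|Q(−2)|₂ ≤ 2^{−⌈m/2⌉}`
  have hhalf : padicNorm 2 (-2 : ℚ) = 2⁻¹ := by
    rw [padicNorm.neg]; have := padicNorm.padicNorm_p_of_prime (p := 2); push_cast at this; exact this
  have hQeval : padicNorm 2 (Q.eval (-2)) ≤ (2 : ℚ) ^ (-(c : ℤ)) := by
    refine padicNorm_eval_le _ _ _ (by positivity) fun k => ?_
    by_cases hk : k < m
    · rw [hQvan k hk, zero_mul, padicNorm.zero]; positivity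
    · rw [padicNorm.mul, padicNorm_pow', hhalf, inv_pow]
      calc padicNorm 2 (Q.coeff k) * ((2 : ℚ) ^ k)⁻¹
          ≤ (2 : ℚ) ^ (k / 2) * ((2 : ℚ) ^ k)⁻¹ :=
            mul_le_mul_of_nonneg_right (hQS k) (by positivity)
        _ = (2 : ℚ) ^ (((k / 2 : ℕ) : ℤ) - (k : ℤ)) := by
            rw [zpow_sub₀ (two_ne_zero), zpow_natCast, zpow_natCast, div_eq_mul_inv]
        _ ≤ (2 : ℚ) ^ (-(c : ℤ)) := zpow_le_zpow_right₀ (by norm_num) (by omega)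
  -- (4) `Q(−2) = P(ℓ_M, −1)`
  have hQev : Q.eval (-2) = MvPolynomial.aeval ![ℓ, -1] P := eval_neg_two_aeval_logTrunc M P
  -- (6) `|ℓ_M|₂ ≤ 2^{log₂ M − M} ≤ 2^{−⌈m/2⌉}` (STEP (e))
  have hℓ : padicNorm 2 ℓ ≤ (2 : ℚ) ^ (-(c : ℤ)) := by
    refine (padicNorm_logTrunc_neg_two_le M).trans (zpow_le_zpow_right₀ (by norm_num) ?_)
    rw [hlogM]; push_cast; omega
  have hℓ1 : padicNorm 2 ℓ ≤ 1 :=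
    hℓ.trans (zpow_le_one_of_nonpos₀ (by norm_num) (by omega))
  -- (7) STEP (d) and the nonarchimedean triangle inequality
  have hd := padicNorm_aeval_sub_eval_le P ℓ hℓ1
  rw [← hQev] at hd
  have hB : padicNorm 2 ((MvPolynomial.eval ![0, -1] P : ℤ) : ℚ) ≤ (2 : ℚ) ^ (-(c : ℤ)) := by
    have e : ((MvPolynomial.eval ![0, -1] P : ℤ) : ℚ)
        = Q.eval (-2) - (Q.eval (-2) - ((MvPolynomial.eval ![0, -1] P : ℤ) : ℚ)) := by ring
    rw [e]
    exact padicNorm.sub.trans (max_le hQeval (hd.trans hℓ))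
  have := (padicNorm.dvd_iff_norm_le (p := 2) (n := c) (z := MvPolynomial.eval ![0, -1] P)).mpr
    (by exact_mod_cast hB)
  exact_mod_cast this

end Summit.Schanuel.Schanuel.Theorems
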